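import Mathlib.CategoryTheory.Limits.Preserves.Shapes.BinaryProducts
import Mathlib.CategoryTheory.Limits.Preserves.Shapes.Terminal
import Mathlib.CategoryTheory.Limits.Preserves.Finite
import Literature.AnabelianGeometry.SemiGraphs.QuasiTemperoidsPropA2vPsi
import Literature.AnabelianGeometry.SemiGraphs.QuasiTemperoidsPropA2Proofs

/-!
# Semi-graphs of anabelioids, Appendix: Proposition A.2 (v), second half — the quasi-morphisms `φ_e = κ[ψ(e), e]` and the product decomposition of `φ`

Mochizuki, *Semi-graphs of anabelioids*, Publ. RIMS **42** (2006), Appendix, Proposition A.2 (v)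
pp. 80–81: "`φ` induces a map `ψ : E → E′`, and, for each `e ∈ E`, a morphism of quasi-temperoids
`φ_e : Q_e → Q′_{ψ(e)}` such that `φ` coincides with the morphism of quasi-temperoids formed by 'taking the
product' [in the evident sense] of the `φ_e`." PROOF-ONLY file (theorems, no definitions) by
abc-iut-w4-d076 over abc-iut-L3-t2's `QuasiTemperoids.lean`; continues `QuasiTemperoidsPropA2vPsi.lean`.

* inclusion functors `ι_{e′}` preserve all colimits and all limits of nonempty shape
  (`preservesColimitsOfShape_inclusion`, `preservesLimitsOfShape_inclusion`);
* in a connected quasi-temperoid a nonempty subterminal object is terminal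
  (`IsConnectedQuasiTemperoid.nonempty_isTerminal_of_subterminal` — in the chart `T[A] ⊆ B^temp(Π)` two
  points of a subterminal object are separated by the orbit `Π/(Stab ∩ Stab)`);
* hence `κ[e′, e] := π_e ∘ φ^* ∘ ι_{e′}` is a quasi-morphism (finite limits: nonempty shapes factorwise,
  the EMPTY shape because a binary-product-preserving functor makes the image of a terminal object
  subterminal, and it is nonempty; countable colimits) preserving nondegenerate objects whenever it
  carries nonempty objects to nonempty objects (`preservesFiniteLimits_kappa`,
  `preservesColimitsOfShape_kappa`, `preservesNondegenerate_kappa`);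
* **`PropA2v_holds`**: with `ψ` of `exists_psi` and `φ_e := κ[ψ(e), e]`, the natural isomorphism
  `φ^* ≅ (A′ ↦ (φ_e^* A′_{ψ(e)})_e)` is, coordinatewise, the `ψ(e)`-th leg of the image of the coproduct
  decomposition `A′ ≅ ∐_{e′} ι_{e′} A′_{e′}` — an isomorphism because the other legs issue from initial
  objects.

[cite: MochizukiSemiAnbd2006, Prop A.2(v) pp.80-81]; typed ≠ endorsed.
-/

open CategoryTheory CategoryTheory.Limits

namespace Literature.AnabelianGeometry.SemiGraphs

open Literature.AlgebraicGeometry.Frobenioids (IsConnectedObj IsNonemptyObj)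
open Literature.AlgebraicGeometry.Frobenioids.QuasiTemperoid (IsConnectedQuasiTemperoid)

universe w w' v₁ v₂ u u₁ u₂

/-! ### Inclusion functors preserve colimits, and limits of nonempty shape -/

section Inclusion

variable {E' : Type} {Q' : E' → Type u₂} [∀ e', Category.{v₂} (Q' e')]

/-- An inclusion functor `ι_{e′} : Q′_{e′} ⥤ ∏ Q′` (factors connected quasi-temperoids) preserves colimits
of every shape: at the coordinate `e′` it is the identity up to isomorphism, at the other coordinates
every object involved is initial. [cite: MochizukiSemiAnbd2006, Prop A.2(v) pp.80-81] -/
theorem preservesColimitsOfShape_inclusion (e' : E') (ι : Q' e' ⥤ ∀ f, Q' f)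
    (hι : IsInclusionFunctor Q' e' ι) (J : Type w) [Category.{w'} J] :
    PreservesColimitsOfShape J ι := by
  refine ⟨fun {D} => ⟨fun {c} hc => Pi.nonempty_isColimit_of_eval _ fun f => ?_⟩⟩
  by_cases hf : f = e'
  · subst hf
    have h1 : IsColimit ((𝟭 (Q' f)).mapCocone c) :=
      IsColimit.ofIsoColimit hc (Cocone.ext (Iso.refl _) fun j => Category.comp_id _)
    exact ⟨IsColimit.mapCoconeEquiv hι.self.some.symm h1⟩
  · exact nonempty_isColimit_of_isInitial _ (fun j => hι.other f hf _) (hι.other f hf _)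

/-- An inclusion functor `ι_{e′} : Q′_{e′} ⥤ ∏ Q′` (factors connected quasi-temperoids) preserves limits
of every NONEMPTY shape (at the other coordinates: cones over diagrams of initial objects, and initial
objects of a connected quasi-temperoid are strict). [cite: MochizukiSemiAnbd2006, Prop A.2(v) pp.80-81] -/
theorem preservesLimitsOfShape_inclusion (hQ' : ∀ f, IsConnectedQuasiTemperoid.{v₂, u₂, u} (Q' f))
    (e' : E') (ι : Q' e' ⥤ ∀ f, Q' f) (hι : IsInclusionFunctor Q' e' ι)
    (J : Type w) [Category.{w'} J] (j₀ : J) : PreservesLimitsOfShape J ι := by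
  refine ⟨fun {D} => ⟨fun {c} hc => Pi.nonempty_isLimit_of_eval _ fun f => ?_⟩⟩
  by_cases hf : f = e'
  · subst hf
    have h1 : IsLimit ((𝟭 (Q' f)).mapCone c) :=
      IsLimit.ofIsoLimit hc (Cone.ext (Iso.refl _) fun j => (Category.id_comp _).symm)
    exact ⟨IsLimit.mapConeEquiv hι.self.some.symm h1⟩
  · exact nonempty_isLimit_of_isInitial _ j₀
      (fun k hB => (hQ' f).nonempty_isInitial_of_hom hB.some k) fun j => hι.other f hf _

end Inclusion

/-! ### Nonempty subterminal objects of a connected quasi-temperoid are terminal -/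

section Subterminal

variable {G : Type u} [Group G] [TopologicalSpace G] [IsTopologicalGroup G]

/-- In `T[A] ⊆ B^temp(Π)` (`Π` tempered): an object `K` with a point, into which any two parallel arrows
agree, has exactly one point — two points `k₁, k₂` are the images of the base point under the two arrows
`Π/(Stab k₁ ∩ Stab k₂) → K` — and is therefore terminal (the constant maps).
[cite: MochizukiSemiAnbd2006, Prop A.2(v) pp.80-81] -/
theorem overPrime_nonempty_isTerminal_of_subterminal (hG : IsTempered G) {A : BTemp G} {K : Over' A}
    (hK : IsNonemptyObj K) (hsub : ∀ {Z : Over' A} (f g : Z ⟶ K), f = g) :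
    Nonempty (IsTerminal K) := by
  obtain ⟨k₀⟩ := overPrime_nonempty_of_isNonemptyObj hK
  letI : MulAction G K.obj.obj.V := Action.instMulAction K.obj.obj
  obtain ⟨pK⟩ := K.property
  -- one point
  have hpt : ∀ k₁ k₂ : K.obj.obj.V, k₁ = k₂ := by
    intro k₁ k₂
    let H : Subgroup G := MulAction.stabilizer G k₁ ⊓ MulAction.stabilizer G k₂
    have hH : IsOpen (H : Set G) := (K.obj.property.2 k₁).inter (K.obj.property.2 k₂)
    obtain ⟨c₁, hc₁⟩ := GaloisObjects.exists_hom_quotientObj hG H hH (X := K.obj) k₁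
      (fun k hk => MulAction.mem_stabilizer_iff.mp (Subgroup.mem_inf.mp hk).1)
    obtain ⟨c₂, hc₂⟩ := GaloisObjects.exists_hom_quotientObj hG H hH (X := K.obj) k₂
      (fun k hk => MulAction.mem_stabilizer_iff.mp (Subgroup.mem_inf.mp hk).2)
    let C : Over' A := ⟨BTemp.quotientObj G hG H hH, ⟨c₁ ≫ pK⟩⟩
    have h := hsub (ObjectProperty.homMk c₁ : C ⟶ K) (ObjectProperty.homMk c₂)
    have h' := congrArg (fun φ : C ⟶ K => (φ.hom.hom.hom ((1 : G) : G ⧸ H) : K.obj.obj.V)) h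
    simp only at h'
    rw [← hc₁, ← hc₂]
    exact h'
  -- the constant maps
  refine ⟨IsTerminal.ofUniqueHom (fun Z => ObjectProperty.homMk (ObjectProperty.homMk
    { hom := TypeCat.ofHom fun _ : Z.obj.obj.V => k₀
      comm := fun _ => by
        apply ConcreteCategory.hom_ext
        intro _
        exact hpt _ _ })) fun Z m => ?_⟩
  apply ObjectProperty.hom_ext
  apply ObjectProperty.hom_ext
  apply Action.hom_ext
  apply ConcreteCategory.hom_ext
  intro _
  exact hpt _ _

variable {Q : Type u₁} [Category.{v₁} Q]

omit [IsTopologicalGroup G] in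
/-- **In a connected quasi-temperoid a nonempty subterminal object is terminal** (transport of
`overPrime_nonempty_isTerminal_of_subterminal` along a chart `Q ≌ T[A]`).
[cite: MochizukiSemiAnbd2006, Prop A.2(v) pp.80-81] -/
theorem _root_.Literature.AlgebraicGeometry.Frobenioids.QuasiTemperoid.IsConnectedQuasiTemperoid.nonempty_isTerminal_of_subterminal
    (hQ : IsConnectedQuasiTemperoid.{v₁, u₁, u} Q) {K : Q} (hK : IsNonemptyObj K)
    (hsub : ∀ {Z : Q} (f g : Z ⟶ K), f = g) : Nonempty (IsTerminal K) := by
  obtain ⟨ch⟩ := isConnectedQuasiTemperoid_iff_nonempty_chart.mp hQ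
  let e := ch.equiv
  have hsub' : ∀ {Z' : Over' ch.A} (f g : Z' ⟶ e.functor.obj K), f = g := by
    intro Z' f g
    have h := hsub (e.inverse.map f ≫ e.unitInv.app K) (e.inverse.map g ≫ e.unitInv.app K)
    exact e.inverse.map_injective ((cancel_mono (e.unitInv.app K)).mp h)
  obtain ⟨hT'⟩ := overPrime_nonempty_isTerminal_of_subterminal ch.isTempered
    (TemperoidTransport.isNonemptyObj_functor_obj e hK) hsub'
  exact ⟨hT'.isTerminalOfObj e.functor K⟩

end Subterminal

/-! ### The quasi-morphisms `κ[e′, e] = π_e ∘ φ^* ∘ ι_{e′}` -/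

section Kappa

variable {E : Type} {Q : E → Type u₁} [∀ e, Category.{v₁} (Q e)]
variable {E' : Type} {Q' : E' → Type u₂} [∀ e', Category.{v₂} (Q' e')]

/-- `κ[e′, e] := π_e ∘ φ^* ∘ ι_{e′}` preserves colimits of every shape that `φ^*` preserves
(`ι_{e′}` and `π_e` preserve all colimits). [cite: MochizukiSemiAnbd2006, Prop A.2(v) pp.80-81] -/
theorem preservesColimitsOfShape_kappa (e' : E') (ι : Q' e' ⥤ ∀ f, Q' f)
    (hι : IsInclusionFunctor Q' e' ι) (F : (∀ f, Q' f) ⥤ ∀ e, Q e) (e : E)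
    (J : Type w) [Category.{w'} J] [PreservesColimitsOfShape J F] :
    PreservesColimitsOfShape J (ι ⋙ F ⋙ Pi.eval Q e) := by
  haveI := preservesColimitsOfShape_inclusion e' ι hι J
  haveI : PreservesColimitsOfShape J (Pi.eval Q e) := TemperoidProduct.preservesColimitsOfShape_eval e
  infer_instance

/-- **`κ[e′, e]` preserves finite limits** whenever it carries nonempty objects to nonempty objects:
nonempty finite shapes factorwise (`ι_{e′}`, `φ^*`, `π_e`); the EMPTY shape — a terminal object `T` of
`Q′_{e′}` — because `κ` preserves binary products, so `κ T ⟵𝟙 κ T ⟶𝟙 κ T` is a product and `κ T` is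
subterminal, and `κ T` is nonempty, hence terminal in the connected quasi-temperoid `Q_e`.
[cite: MochizukiSemiAnbd2006, Prop A.2(v) pp.80-81] -/
theorem preservesFiniteLimits_kappa (hQ : ∀ e, IsConnectedQuasiTemperoid.{v₁, u₁, u} (Q e))
    (hQ' : ∀ f, IsConnectedQuasiTemperoid.{v₂, u₂, u} (Q' f)) (e' : E') (ι : Q' e' ⥤ ∀ f, Q' f)
    (hι : IsInclusionFunctor Q' e' ι) (F : (∀ f, Q' f) ⥤ ∀ e, Q e) [PreservesFiniteLimits F] (e : E)
    (hb : ∀ N : Q' e', IsNonemptyObj N → IsNonemptyObj ((F.obj (ι.obj N)) e)) :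
    PreservesFiniteLimits (ι ⋙ F ⋙ Pi.eval Q e) := by
  refine ⟨fun J _ _ => ?_⟩
  haveI : PreservesLimitsOfShape J (Pi.eval Q e) := TemperoidProduct.preservesLimitsOfShape_eval e
  by_cases hJ : Nonempty J
  · obtain ⟨j₀⟩ := hJ
    haveI := preservesLimitsOfShape_inclusion hQ' e' ι hι J j₀
    infer_instance
  · rw [not_nonempty_iff] at hJ
    refine ⟨fun {D} => ⟨fun {c} hc => ?_⟩⟩
    obtain ⟨hT⟩ := nonempty_isTerminal_of_isLimit_of_isEmpty hc
    -- `κ T` is subterminal: `κ` preserves the product `T ⟵𝟙 T ⟶𝟙 T`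
    haveI := preservesLimitsOfShape_inclusion hQ' e' ι hι (Discrete WalkingPair) ⟨WalkingPair.left⟩
    haveI : PreservesLimitsOfShape (Discrete WalkingPair) (Pi.eval Q e) :=
      TemperoidProduct.preservesLimitsOfShape_eval e
    have h2 : IsLimit (BinaryFan.mk ((ι ⋙ F ⋙ Pi.eval Q e).map (𝟙 c.pt))
        ((ι ⋙ F ⋙ Pi.eval Q e).map (𝟙 c.pt))) :=
      mapIsLimitOfPreservesOfIsLimit (ι ⋙ F ⋙ Pi.eval Q e) _ _
        (nonempty_isLimit_binaryFan_id_of_isTerminal hT).some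
    rw [CategoryTheory.Functor.map_id] at h2
    have hsub : ∀ {Z : Q e} (f g : Z ⟶ (ι ⋙ F ⋙ Pi.eval Q e).obj c.pt), f = g :=
      fun f g => eq_of_isLimit_binaryFan_id h2 f g
    -- `κ T` is nonempty: `T` is (it receives an arrow from a connected object)
    have hne : IsNonemptyObj c.pt := by
      obtain ⟨N, hN, -⟩ := (hQ' e').exists_isConnectedObj_isNondegenerateObj
      exact (hQ' e').isNonemptyObj_of_hom (hT.from N) hN.1
    exact nonempty_isLimit_of_isEmpty_of_isTerminal _
      ((hQ e).nonempty_isTerminal_of_subterminal (hb _ hne) hsub)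

/-- `κ[e′, e]` preserves nondegenerate objects whenever it carries nonempty objects to nonempty objects
(nondegenerate = nonempty in a connected quasi-temperoid). [cite: MochizukiSemiAnbd2006, Prop A.2(v) pp.80-81] -/
theorem isNondegenerateObj_kappa (hQ : ∀ e, IsConnectedQuasiTemperoid.{v₁, u₁, u} (Q e))
    (hQ' : ∀ f, IsConnectedQuasiTemperoid.{v₂, u₂, u} (Q' f)) (e' : E') (ι : Q' e' ⥤ ∀ f, Q' f)
    (F : (∀ f, Q' f) ⥤ ∀ e, Q e) (e : E)
    (hb : ∀ N : Q' e', IsNonemptyObj N → IsNonemptyObj ((F.obj (ι.obj N)) e))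
    (N : Q' e') (hN : IsNondegenerateObj N) : IsNondegenerateObj ((ι ⋙ F ⋙ Pi.eval Q e).obj N) :=
  fun _ hB => (hQ e).exists_isConnectedObj_hom_hom hB.1
    (hb N ((hQ' e').isNonemptyObj_of_isNondegenerateObj hN))

end Kappa

/-! ### Proposition A.2 (v) -/

section Assembly

/-- **Proposition A.2 (v), DISCHARGED** (SemiAnbd Appendix pp. 80–81; PRIMS p. 310): "If `φ` is a
morphism of quasi-temperoids, then `φ` induces a map `ψ : E → E′`, and, for each `e ∈ E`, a morphism of
quasi-temperoids `φ_e : Q_e → Q′_{ψ(e)}` such that `φ` coincides with the morphism of quasi-temperoids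
formed by 'taking the product' [in the evident sense] of the `φ_e`." With inclusion functors `ι_{e′}`
(Prop. A.2 (ii), `PropA2ii_holds`), `ψ` is the map of `exists_psi` and `φ_e^* := κ[ψ(e), e] =
π_e ∘ φ^* ∘ ι_{ψ(e)}` (a morphism of quasi-temperoids by `preservesFiniteLimits_kappa`,
`preservesColimitsOfShape_kappa`, `isNondegenerateObj_kappa`); the isomorphism
`φ^* ≅ (A′ ↦ (φ_e^* A′_{ψ(e)})_e)` is, at the coordinate `e`, the `ψ(e)`-th leg of the image under
`π_e ∘ φ^*` of the coproduct decomposition `A′ ≅ ∐_{e′} ι_{e′} A′_{e′}` (`exists_cofan_decomposition`) — an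
isomorphism since the other legs issue from initial objects (`isIso_inj_of_isColimit_cofan`).
[cite: MochizukiSemiAnbd2006, Prop A.2(v) pp.80-81] -/
theorem PropA2v_holds : PropA2v.{v₁, v₂, u, u₁, u₂} := by
  intro E _ Q _ E' _ Q' _ hQ hQ' φ hφ
  classical
  -- inclusion functors (Prop. A.2 (ii))
  have hι₀ : ∀ e', ∃ ι : Q' e' ⥤ ∀ f, Q' f, IsInclusionFunctor Q' e' ι := (PropA2ii_holds Q' hQ').1
  choose ι hι using hι₀
  obtain ⟨ψ, hψ⟩ := exists_psi hQ hQ' ι hι φ hφ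
  obtain ⟨j, -, hjnat, hjcol⟩ := exists_cofan_decomposition ι hι
  let F := φ.pullback
  haveI := φ.preservesFiniteLimits
  haveI : PreservesColimitsOfShape (Discrete E') F := φ.preservesCountableColimits (Discrete E')
  haveI : ∀ e, PreservesColimitsOfShape (Discrete E') (Pi.eval Q e) :=
    fun e => TemperoidProduct.preservesColimitsOfShape_eval e
  -- the quasi-morphisms `φ_e := κ[ψ e, e]`
  let φe : ∀ e, TemperoidHom (Q e) (Q' (ψ e)) := fun e =>
    { pullback := ι (ψ e) ⋙ F ⋙ Pi.eval Q e
      preservesFiniteLimits :=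
        preservesFiniteLimits_kappa hQ hQ' (ψ e) (ι (ψ e)) (hι (ψ e)) F e (hψ e).2
      preservesCountableColimits := fun J _ _ => by
        haveI : PreservesColimitsOfShape J F := φ.preservesCountableColimits J
        exact preservesColimitsOfShape_kappa (ψ e) (ι (ψ e)) (hι (ψ e)) F e J }
  refine ⟨ψ, φe, fun e N hN => isNondegenerateObj_kappa hQ hQ' (ψ e) (ι (ψ e)) F e (hψ e).2 N hN,
    ⟨?_⟩⟩
  -- the natural isomorphism: coordinatewise, the `ψ e`-th leg of the image of the decomposition cofan
  have hdec : ∀ (A' : ∀ f, Q' f) (e : E),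
      IsColimit (Cofan.mk ((F.obj A') e) fun e' => (F.map (j A' e')) e) := fun A' e =>
    isColimitCofanMkObjOfIsColimit (Pi.eval Q e) _ _
      (isColimitCofanMkObjOfIsColimit F _ _ (hjcol A').some)
  have hleg : ∀ (A' : ∀ f, Q' f) (e : E), IsIso ((F.map (j A' (ψ e))) e) := fun A' e =>
    isIso_inj_of_isColimit_cofan (hdec A' e) (ψ e) fun e' he' =>
      TemperoidProduct.nonempty_isInitial_of_not_isNonemptyObj ((hψ e).1 e' he' (A' e'))
  refine (NatIso.ofComponents
    (fun A' => Pi.isoMk fun e => @asIso _ _ _ _ ((F.map (j A' (ψ e))) e) (hleg A' e)) ?_).symm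
  intro A' B' g
  funext e
  have h := congrArg (fun k => (F.map k) e) (hjnat A' B' g (ψ e))
  simp only [Functor.map_comp] at h
  exact h

end Assembly

end Literature.AnabelianGeometry.SemiGraphs
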